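import Summits.AtomisticToContinuum.Crystallization.Theorems.ChargedEnergyGapChartDialG

/-!
# `ChargedEnergyGap` · the CHART DIAL, part H: CHAINS — decomp-a2c lens-3 g38 node «ScaleCoherence» (3/3), the residual of UPGRADE

Parts E–G proved the local half of UPGRADE (`UpgradeWitness θ R M R'`, part D §4): the shell margin, the first rung (cores in
the shell ball), charted surround / shell exit, and the ONE-HOP HARNACK inequality `nn u ≥ (3/4)·nn p` along a charted shell hop.
This part isolates what is left — scale coherence along CHAINS of charted hops — and proves the assembly.

§1 TRANSLATION INVARIANCE of the chart (`shellSet_transl`, `chartedAt_transl_iff`; every point is a translate of a motif point).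
§2 SECOND RUNG (proved, `θ ≤ 3/20`): a core in the shell ball of a CHARTED shell member of `x` is a comparable witness,
   `NearGrossCmp θ R (80/3) Q (pt Q x)` for `R ≥ 253/100` (`nearGrossCmp_of_core_in_second_shell`; one-hop Harnack × margin).
§3 THE RESIDUAL, typed: `ChainHarnack θ R₀ M₀` — along every chain of charted shell hops staying in `B̄(x, R₀·nn x)` the own
   scale never drops below `nn x / M₀` (NO COMPOUNDING ZOOM inside `R₀` scales; one hop gives the factor `3/4`, part G).
   GEOMETRIC, energy-free, QUANTITATIVE in `(θ, R₀)` — NOT a rigidity statement: CONFORMAL ZOOMS EXIST.  The inversion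
   `x ↦ x/|x|²` of the fcc lattice (unit bonds) restricted to `|x| ≥ N` is `θ`-charted as soon as `N ≥ N(θ) ≈ 2/θ + 1` (the
   inverted shell at `|x| = N` has nn-normalised radii spread over `[1, (N+1)/(N−1)]`; local estimate with the differential's
   reflection as the chart isometry refined over all rotations, bottleneck matching, 150 sites per radius, fcc | hcp:
   `η(12) = 0.179`, `η(13) = 0.166 | 0.166`, `η(14) = 0.152 | 0.153`, `η(15) = 0.141 | 0.141`, `η(16) = 0.133 | 0.130`,
   `η(18) = 0.117 | 0.115` ≈ `0.98·2/(N−1)`; no clean 12-shell for `N ≤ 7`; so `N(3/20) = 15` for both lattices), its scale `nn = 1/(|x|(|x|+1))` shrinks to `0` along charted chains converging to the pole, and a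
   finite annulus of it sits in a large periodic box: hence `ChainHarnack θ R₀ M₀` is FALSE for `R₀ ≥ N(θ)` (every `M₀`) and
   forces `M₀ ≥ (N(θ)/(N(θ) − R₀))²` below (`≈ 2.8` at `(3/20, 6)`); the BALL version (all charted sites of `B̄(x, R₀ nn x)`
   comparable) is false already for small `R₀` (a floating small crystallite), so the chain condition is essential too.
   A second, self-similar family — a hollow-stacked COLUMN of triangular layers shrinking by `λ` per layer (layer `j+1 = S(layer j)`,
   `S` a similarity of ratio `λ` with vertical axis; only the column sites need be charted) — is `3/20`-charted iff `λ ≥ 0.907`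
   (local optimisation over offset, layer height, twist; bottleneck matching, full rotation group), with zoom horizon
   `≈ 0.86/(1 − λ) ≥ 11.5` start-scales and zoom `≤ 2.1` inside `6`; at `λ = 0.85` (horizon `5.5 < 6`) the defect is `> 3/20` by a
   wide margin.  The third family is the dangerous one: LOXODROMIC layered zooms `layer j+1 = S(layer j)` with `S = λ·R_ω + t`,
   `R_ω` a rotation by `ω` per hop about a TILTED (here horizontal) axis — the layers fan out about the axis line and the chain
   `p_j = S^j(p₀)` is a logarithmic spiral converging to the fixed point of `S`, so the horizon is `|t|/|1 − λe^{iω}|`, much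
   shorter than the column's `|t_∥|/(1 − λ)`.  Optimising `(λ, ω, axis, t)` (triangular layer patches of radius `2.6`, all images
   `S^i`, `|i| ≤ 30`, within `4` spacings; bottleneck matching, full rotation group) under a cap on the excursion
   `max_j |p_j − p₀| / nn p₀` gives the minimal chart defect `0.199` (cap `5.0`) · `0.168` (cap `5.9`) · `0.156` (cap `6.3`) · `0.147`
   (cap `6.6`): the design `λ = 0.8895`, `ω = 7.43°`, `t = p₁` the nearest neighbour, is `3/20`-CHARTED (defect `0.1474`, clean
   `12`-shell, next point at `1.36 nn`) with an INFINITE zoom of excursion `6.60` start-scales (apex at `6.07`, minimal enclosing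
   ball of the chain: radius `3.30` with `p₀` on its boundary; zoom `3.2` before the chain first leaves `B̄(p₀, 6 nn p₀)`).  HENCE:
   `ChainHarnack (3/20) (33/5) M₀` is FALSE for every `M₀`; `ChainHarnack (3/20) 6 M₀` needs `M₀ ≥ 3.2` and survives this family
   only by the defect margin `0.165` vs `3/20` — the dials `(θ, R₀) = (3/20, 6)` (`R = 3`) are a KNIFE-EDGE; at `R₀ = 4` (`R = 2`)
   the family's defect is `≥ 0.2` and the Möbius bound is `M₀ ≥ (15/11)² ≈ 1.9`.  RECOMMENDED DIALS: `R = 2`, i.e. the literal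
   `UpgradeWitness (3/20) 2 (20·M₀) 4` from `ChainHarnackIn (3/20) 2 M₀` (price: `FarFieldPricing (3/20) 2`).
   IDEA: DISCRETE LIOUVILLE STABILITY — by Liouville's theorem the smooth conformal zooms of `ℝ³` are Möbius, whose zoom inside
   `B̄(x, R₀ nn x)` is `≤ (N/(N − R₀))²`; a `θ`-charted cluster is only QUASI-conformal with constant `θ`, and the loxodromes
   show the quasi-Möbius deviation at `θ = 3/20` is of order one at `6` scales: the statement to prove is a quantitative
   Reshetnyak / Faraco–Zhong (2005) stability of conformal matrices (the conformal analogue of Friesecke–James–Müller) at the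
   SMALLER radius `R₀ = 4`, with the one-hop Harnack inequality as the Lipschitz input.  INSTRUMENTABLE (census I-ZOOM: (a) certify
   `N(3/20)` for inverted fcc/hcp; (b) minimise the excursion of `3/20`-charted infinite zooms over similarity-orbit clusters with
   curved layers — flat layers give `6.6`; a value `≤ 4` kills the recommended dial too).
   TWO FORMS: `ChainHarnack θ R₀ M₀` (chains in `B̄(x, R₀ nn x)`) and the weaker, ball-anywhere form actually consumed by the
   assembly, `ChainHarnackIn θ R M₀` (chains in some `B̄(c, D) ∋ x` with `D ≤ R nn x`; `ChainHarnack θ (2R) M₀` implies it).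
   PROVED RUNG: `chainHarnack_shell : ChainHarnack θ (6/5) (4/3)` (`θ ≤ 3/20`; the trivial end of the `R₀`-dial, one hop).
§4 THE ASSEMBLY (proved, `θ ≤ 3/20`): `upgradeWitness_of_chainHarnackIn` —
   `ChainHarnackIn θ R M₀ ∧ ChargeFreeCharted θ ⟹ UpgradeWitness θ R (20·M₀) (2R)` (and `upgradeWitness_of_chainHarnack`
   from `ChainHarnack θ (2R) M₀`).
   Extremal argument: among the (finitely many, `finite_inter_points`) sites reachable from `x` by charted hops inside
   `B̄(z, dist x z)` take one, `p`, closest to the core `z`; either `z` lies in `p`'s shell ball (margin: `nn z ≥ nn p/20 ≥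
   nn x/(20 M₀)`, witness `z`), or shell exit gives a shell point `q` of `p` strictly closer to `z`: `q` charted contradicts
   minimality, `q` uncharted is CHARGED by the dictionary hypothesis and is the witness (`nn q ≥ nn p/20`, `dist x q ≤ 2 dist x z`).
   Hence `FarFieldPricing θ R ∧ ChainHarnack θ (2R) M₀ ∧ ChargeFreeCharted θ ⟹ ChartedChargePricing θ`
   (`chartedChargePricing_of_far_chainHarnack`).  The dictionary hypothesis `ChargeFreeCharted θ` (part A §2, an ASIDE:
   refuted for `θ < 1/20`, open at the dial `θ = 3/20`, decided by the amplitude of the charge-free «jitterbug» twist of the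
   two dozens — census I-CHART(b)) enters ONLY at the exit step; without it the exit point may be a charge-free uncharted
   (twisted) dozen, which is no gross-charged witness — that case is the TWIST PRICING question of the dictionary remark (part B §5).
-/

noncomputable section

open Literature.MathematicalPhysics.StatisticalMechanics
open Literature.Geometry.DiscreteGeometry
open Summit.AtomisticToContinuum.Crystallization.Theses.PricedLinkCensus
open Summit.AtomisticToContinuum.Crystallization.Theorems.ChargedEnergyGapNegative
open RealInnerProductSpace
namespace Summit.AtomisticToContinuum.Crystallization.Theorems.ChargedEnergyGapChartDial

/-! ## §1 Translation invariance of the chart -/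

section transl

variable (Q : PeriodicConfiguration 3)

/-- Coordinates of a motif site as a point of `Q` (a `rfl` bridge; use it with `rw`, since unifying the two coercions
`↑(pt Q x)` and `↑x` directly can be expensive for the elaborator). -/
theorem coe_pt (x : Q.motif) : ((pt Q x : Q.points) : E3) = (x : E3) := rfl

/-- The normalised shell is translation invariant. -/
theorem shellSet_transl {g : E3} (hg : g ∈ Q.lattice) (p : Q.points) :
    shellSet Q (Blocks.transl Q hg p) = shellSet Q p := by
  have hn : nn Q (Blocks.transl Q hg p) = nn Q p := Blocks.nearestDist_transl Q hg p
  have hco : ((Blocks.transl Q hg p : Q.points) : E3) = (p : E3) + g := rfl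
  ext v
  simp only [shellSet, Set.mem_image, Set.mem_setOf_eq, hn, hco]
  constructor
  · rintro ⟨q, ⟨hq, hqp, hqd⟩, rfl⟩
    refine ⟨q - g, ⟨?_, ?_, ?_⟩, ?_⟩
    · have := Q.add_mem_points hq (Q.lattice.neg_mem hg); simpa [sub_eq_add_neg] using this
    · intro h; apply hqp; rw [← h]; abel
    · rwa [show dist (p : E3) (q - g) = dist ((p : E3) + g) q by
        rw [dist_eq_norm, dist_eq_norm]; congr 1; abel]
    · congr 1; abel
  · rintro ⟨q, ⟨hq, hqp, hqd⟩, rfl⟩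
    refine ⟨q + g, ⟨Q.add_mem_points hq hg, fun h => hqp (add_right_cancel h), ?_⟩, ?_⟩
    · rwa [show dist ((p : E3) + g) (q + g) = dist (p : E3) q by
        rw [dist_eq_norm, dist_eq_norm]; congr 1; abel]
    · congr 1; abel

/-- `ChartedAt` is translation invariant. -/
theorem chartedAt_transl_iff {θ : ℝ} {g : E3} (hg : g ∈ Q.lattice) (p : Q.points) :
    ChartedAt θ Q (Blocks.transl Q hg p) ↔ ChartedAt θ Q p := by
  simp only [ChartedAt, shellSet_transl]

/-- Every point of `Q` is a lattice translate of a motif point. -/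
theorem exists_eq_transl_pt (q : Q.points) :
    ∃ (y : Q.motif) (g : E3) (hg : g ∈ Q.lattice), q = Blocks.transl Q hg (pt Q y) := by
  obtain ⟨y, hy, g, hg, h⟩ := q.2
  exact ⟨⟨y, hy⟩, g, hg, Subtype.ext h⟩

/-- A translate of an uncharted motif point is not a charted point. -/
theorem transl_ne_of_charted {θ : ℝ} {y : Q.motif} (hU : ¬ ChartedAt θ Q (pt Q y)) {g : E3} (hg : g ∈ Q.lattice)
    {p : Q.points} (hp : ChartedAt θ Q p) : Blocks.transl Q hg (pt Q y) ≠ p := by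
  intro h
  rw [← h, chartedAt_transl_iff] at hp
  exact hU hp

end transl

/-! ## §2 Second rung of UPGRADE: cores in the shell ball of a charted shell member -/

section rung

variable (Q : PeriodicConfiguration 3)

/-- **UPGRADE's second rung** (`θ ≤ 3/20`): a defect core `y + g` in the `6/5`-shell ball of a CHARTED member `u` of the
shell of a charted site `x` is a comparable witness for `x`: `NearGrossCmp θ R (80/3) Q (pt Q x)` for `R ≥ 253/100`
(one-hop Harnack `nn u ≥ (3/4) nn x`, margin `nn (y + g) ≥ nn u / 20`). -/
theorem nearGrossCmp_of_core_in_second_shell {θ R : ℝ} (hθ : θ ≤ 3 / 20) (hR : 253 / 100 ≤ R)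
    {x y : Q.motif} {g : E3} (hg : g ∈ Q.lattice) (hC : Charged Q y) (hU : ¬ ChartedAt θ Q (pt Q y))
    (hx : ChartedAt θ Q (pt Q x)) {u : Q.points} (hu : ChartedAt θ Q u) (hux : u ≠ pt Q x)
    (hxu : dist (x : E3) u ≤ 6 / 5 * nn Q (pt Q x)) (hd : dist (u : E3) ((y : E3) + g) ≤ 6 / 5 * nn Q u) :
    NearGrossCmp θ R (80 / 3) Q (pt Q x) := by
  have hcx : 0 < nn Q (pt Q x) := Blocks.nearestDist_pt_pos Q _
  have hcu : 0 < nn Q u := Blocks.nearestDist_pt_pos Q _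
  -- the core as a point of `Q`
  obtain ⟨z, hzv, hnnz, hzu⟩ : ∃ z : Q.points, (z : E3) = (y : E3) + g ∧ nn Q z = nn Q (pt Q y) ∧ z ≠ u :=
    ⟨Blocks.transl Q hg (pt Q y), rfl, Blocks.nearestDist_transl Q hg (pt Q y), transl_ne_of_charted Q hU hg hu⟩
  have hmargin : (1 / 5 - θ) * nn Q u ≤ nn Q z := nn_shell_ge Q (by linarith) hu hzu (by rw [hzv]; exact hd)
  have hxu' : dist ((pt Q x : Q.points) : E3) u ≤ 6 / 5 * nn Q (pt Q x) := by rw [coe_pt]; exact hxu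
  obtain ⟨hhop, hup⟩ := nn_hop_bounds Q hθ hx hu hux hxu'
  have hdxu := dist_le_of_mem_shellBall Q hx hux hxu'
  have h1 : (1 + θ) * nn Q (pt Q x) ≤ 23 / 20 * nn Q (pt Q x) := mul_le_mul_of_nonneg_right (by linarith) hcx.le
  have h3 : 1 / 20 * nn Q u ≤ (1 / 5 - θ) * nn Q u := mul_le_mul_of_nonneg_right (by linarith) hcu.le
  rw [hnnz] at hmargin
  refine ⟨y, g, hg, hC, hU, ?_, ?_⟩
  · calc dist ((pt Q x : Q.points) : E3) ((y : E3) + g)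
          ≤ dist ((pt Q x : Q.points) : E3) u + dist (u : E3) ((y : E3) + g) := dist_triangle _ _ _
      _ ≤ (1 + θ) * nn Q (pt Q x) + 6 / 5 * nn Q u := add_le_add hdxu hd
      _ ≤ 253 / 100 * nn Q (pt Q x) := by linarith only [h1, hup]
      _ ≤ R * nn Q (pt Q x) := mul_le_mul_of_nonneg_right hR hcx.le
  · linarith only [hhop, h3, hmargin]

end rung

/-! ## §3 The residual of UPGRADE: no compounding zoom along charted chains -/

/-- A CHARTED SHELL HOP `a → b`: both ends `θ`-charted, `b ≠ a` in the `6/5`-shell ball of `a`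
(so `nn b ∈ [3/4, 1 + θ]·nn a`, part G `nn_hop_bounds`). -/
def ChartedHop (θ : ℝ) (Q : PeriodicConfiguration 3) (a b : Q.points) : Prop :=
  ChartedAt θ Q a ∧ ChartedAt θ Q b ∧ b ≠ a ∧ dist (a : E3) b ≤ 6 / 5 * nn Q a

/-- piece NOZOOM · residual of UPGRADE · GEOMETRIC (no energy) · QUANTITATIVE in `(θ, R₀)`: FALSE for `R₀ ≥ N(θ) ≈ 2/θ + 1`
(inverted fcc lattice — a CONFORMAL ZOOM, `θ`-charted beyond lattice radius `N(θ)`, `N(3/20) ≈ 15`, embedded as a finite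
annulus in a large periodic box) and FALSE at `(3/20, 33/5)` (every `M₀`: the LOXODROMIC layered zoom of the file header,
a `3/20`-charted logarithmic spiral of hops with excursion `6.6` start-scales); at the dials `(3/20, 6)` (`R = 3`) it needs
`M₀ ≥ 3.2` and is a KNIFE-EDGE (loxodromic defect `0.165` vs `3/20`); TRUE-type expected at `(3/20, 4)` (`R = 2`, loxodromic
defect `≥ 0.2`, Möbius bound `(15/11)²`) · IDEA-NEEDED (quantitative discrete Liouville STABILITY: `θ`-charted clusters are
quasi-Möbius, Reshetnyak / Faraco–Zhong rigidity of conformal matrices; one hop is part G, `k` hops give `(4/3)^k` trivially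
— the content is length-independence inside the ball) · INSTRUMENTABLE (census I-ZOOM).  Why it might fail: a charted zoom
with CURVED layers spiralling faster than the flat-layer loxodromes — excursion `≤ 4` at defect `≤ 3/20` kills `R = 2` too.
**Chain Harnack**: along every chain of charted shell hops from a charted `x` staying in `B̄(x, R₀·nn x)` the own scale
stays `≥ nn x / M₀`. -/
def ChainHarnack (θ R₀ M₀ : ℝ) : Prop :=
  ∀ (Q : PeriodicConfiguration 3) (x p : Q.points), ChartedAt θ Q x →
    Relation.ReflTransGen (fun a b : Q.points => ChartedHop θ Q a b ∧ dist (x : E3) b ≤ R₀ * nn Q x) x p →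
    nn Q x ≤ M₀ * nn Q p

/-- piece NOZOOM, ball-anywhere form (the hypothesis the assembly consumes; WEAKER than `ChainHarnack θ (2R) M₀`,
`chainHarnackIn_of_chainHarnack`): along every chain of charted shell hops from a charted `x` staying in a ball
`B̄(c, D) ∋ x` of radius `D ≤ R·nn x` the own scale stays `≥ nn x / M₀`.  Same status as `ChainHarnack`: the loxodromic
zoom fits in a ball of radius `3.30` start-scales through `x`, so `ChainHarnackIn (3/20) (33/10) M₀` is FALSE for every `M₀`
and `R = 3` is a knife-edge; recommended dial `R = 2`. -/
def ChainHarnackIn (θ R M₀ : ℝ) : Prop :=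
  ∀ (Q : PeriodicConfiguration 3) (x p : Q.points) (c : E3) (D : ℝ), ChartedAt θ Q x →
    dist (x : E3) c ≤ D → D ≤ R * nn Q x →
    Relation.ReflTransGen (fun a b : Q.points => ChartedHop θ Q a b ∧ dist (b : E3) c ≤ D) x p →
    nn Q x ≤ M₀ * nn Q p

/-- Monotonicity of `Relation.ReflTransGen` in the relation, in application form. -/
theorem reflTransGen_of_imp {α : Type*} {r p : α → α → Prop} {a b : α} (hab : Relation.ReflTransGen r a b)
    (h : ∀ a b, r a b → p a b) : Relation.ReflTransGen p a b := by
  induction hab with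
  | refl => exact Relation.ReflTransGen.refl
  | tail _ hbc ih => exact ih.tail (h _ _ hbc)

/-- `ChainHarnack` forces `M₀ ≥ 1` (the empty chain) whenever some configuration has a `θ`-charted point. -/
theorem one_le_of_chainHarnack {θ R₀ M₀ : ℝ} (h : ChainHarnack θ R₀ M₀) {Q : PeriodicConfiguration 3} {x : Q.points}
    (hx : ChartedAt θ Q x) : 1 ≤ M₀ := by
  have := h Q x x hx Relation.ReflTransGen.refl
  have hc : 0 < nn Q x := Blocks.nearestDist_pt_pos Q x
  nlinarith

/-- `ChainHarnack` is monotone: a larger `M₀` and a smaller ball are weaker. -/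
theorem chainHarnack_mono {θ R₀ R₁ M₀ M₁ : ℝ} (hR : R₁ ≤ R₀) (hM : M₀ ≤ M₁) (h : ChainHarnack θ R₀ M₀) :
    ChainHarnack θ R₁ M₁ := by
  intro Q x p hx hp
  have hc : 0 ≤ nn Q x := nearestDist_nonneg _ _
  have h1 := h Q x p hx
    (reflTransGen_of_imp hp fun a b hab => ⟨hab.1, hab.2.trans (mul_le_mul_of_nonneg_right hR hc)⟩)
  exact h1.trans (mul_le_mul_of_nonneg_right hM (nearestDist_nonneg _ _))

/-- The `x`-centred form at radius `2R` implies the ball-anywhere form at radius `R` (triangle inequality). -/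
theorem chainHarnackIn_of_chainHarnack {θ R M₀ : ℝ} (h : ChainHarnack θ (2 * R) M₀) : ChainHarnackIn θ R M₀ := by
  intro Q x p c D hx hxc hD hp
  refine h Q x p hx (reflTransGen_of_imp hp fun a b hab => ⟨hab.1, ?_⟩)
  have tri := dist_triangle (x : E3) c (b : E3)
  have hbc : dist c (b : E3) ≤ D := by rw [dist_comm]; exact hab.2
  linarith

/-- `ChainHarnackIn` is monotone: a larger `M₀` and a smaller radius are weaker. -/
theorem chainHarnackIn_mono {θ R₀ R₁ M₀ M₁ : ℝ} (hR : R₁ ≤ R₀) (hM : M₀ ≤ M₁) (h : ChainHarnackIn θ R₀ M₀) :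
    ChainHarnackIn θ R₁ M₁ := by
  intro Q x p c D hx hxc hD hp
  have hX : 0 < nn Q x := Blocks.nearestDist_pt_pos Q x
  have hP : 0 < nn Q p := Blocks.nearestDist_pt_pos Q p
  have h1 := h Q x p c D hx hxc (hD.trans (mul_le_mul_of_nonneg_right hR hX.le)) hp
  nlinarith only [h1, hM, hP]

/-- **The trivial end of the `R₀`-dial** (a PROVED rung of NOZOOM): inside the shell ball every chain member is one charted
hop from `x` itself, so one-hop Harnack gives `ChainHarnack θ (6/5) (4/3)` for `θ ≤ 3/20`.  (The content of NOZOOM is the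
passage from `R₀ = 6/5` to `R₀ = 2R = 6`, exactly as UPGRADE is the passage of the collar radius from `6/5` to `R`, part F §1.) -/
theorem chainHarnack_shell {θ : ℝ} (hθ : θ ≤ 3 / 20) : ChainHarnack θ (6 / 5) (4 / 3) := by
  intro Q x p hx hp
  have hc : 0 < nn Q x := Blocks.nearestDist_pt_pos Q x
  rcases hp.cases_tail with rfl | ⟨c, -, hcp⟩
  · linarith
  · obtain ⟨⟨-, hpc, -, -⟩, hd⟩ := hcp
    by_cases hpx : p = x
    · subst hpx; linarith
    · have := nn_ge_of_charted_hop Q hθ hx hpc hpx hd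
      linarith

/-! ## §4 The assembly: UPGRADE from chain Harnack and the dictionary -/

section assembly

variable (Q : PeriodicConfiguration 3)

/-- **UPGRADE ⟸ NOZOOM ∧ DICTIONARY** (`θ ≤ 3/20`, extremal charted-chain argument):
`ChainHarnackIn θ R M₀ → ChargeFreeCharted θ → UpgradeWitness θ R (20·M₀) (2R)`. -/
theorem upgradeWitness_of_chainHarnackIn {θ R M₀ : ℝ} (hθ : θ ≤ 3 / 20) (hM₀ : 0 ≤ M₀)
    (hH : ChainHarnackIn θ R M₀) (hD : ChargeFreeCharted θ) : UpgradeWitness θ R (20 * M₀) (2 * R) := by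
  intro Q x _ hx hn
  obtain ⟨y, g, hg, hC, hU, hd⟩ := hn
  have hcX : 0 < nn Q (pt Q x) := Blocks.nearestDist_pt_pos Q _
  -- the core as a point of `Q`
  obtain ⟨z, hzv, hnnz, hzU⟩ : ∃ z : Q.points, (z : E3) = (y : E3) + g ∧ nn Q z = nn Q (pt Q y) ∧
      ∀ p : Q.points, ChartedAt θ Q p → z ≠ p :=
    ⟨Blocks.transl Q hg (pt Q y), rfl, Blocks.nearestDist_transl Q hg (pt Q y),
      fun p hp => transl_ne_of_charted Q hU hg hp⟩
  obtain ⟨D₀, hD₀⟩ : ∃ D₀ : ℝ, dist ((pt Q x : Q.points) : E3) (z : E3) = D₀ := ⟨_, rfl⟩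
  have hD₀R : D₀ ≤ R * nn Q (pt Q x) := by rw [← hD₀, hzv]; exact hd
  have hRn : 0 ≤ R * nn Q (pt Q x) := dist_nonneg.trans hd
  -- the confined charted-hop relation; reachable sites are charted, within `D₀` of the core, and comparable (Harnack)
  let rel : Q.points → Q.points → Prop := fun a b => ChartedHop θ Q a b ∧ dist (b : E3) z ≤ D₀
  have hfacts : ∀ p : Q.points, Relation.ReflTransGen rel (pt Q x) p → ChartedAt θ Q p ∧ dist (p : E3) z ≤ D₀ := by
    intro p hp
    rcases hp.cases_tail with rfl | ⟨c, -, hcp⟩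
    · exact ⟨hx, hD₀.le⟩
    · exact ⟨hcp.1.2.1, hcp.2⟩
  have hharnack : ∀ p : Q.points, Relation.ReflTransGen rel (pt Q x) p → nn Q (pt Q x) ≤ M₀ * nn Q p :=
    fun p hp => hH Q (pt Q x) p (z : E3) D₀ hx hD₀.le hD₀R hp
  -- finiteness of the reachable set and a closest-to-core reachable site `p`
  have hfin : (Metric.closedBall (z : E3) D₀ ∩ Q.points).Finite := Q.finite_inter_points Metric.isBounded_closedBall
  have hSfin : {p : Q.points | Relation.ReflTransGen rel (pt Q x) p}.Finite := by
    refine (hfin.preimage Subtype.val_injective.injOn).subset fun p hp => ?_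
    exact ⟨Metric.mem_closedBall.2 (hfacts p hp).2, p.2⟩
  obtain ⟨p, hpF, hmin⟩ := hSfin.toFinset.exists_min_image (fun p : Q.points => dist (p : E3) z)
    ⟨pt Q x, hSfin.mem_toFinset.2 Relation.ReflTransGen.refl⟩
  have hpS : Relation.ReflTransGen rel (pt Q x) p := hSfin.mem_toFinset.1 hpF
  obtain ⟨hpc, hpz⟩ := hfacts p hpS
  have hcp : 0 < nn Q p := Blocks.nearestDist_pt_pos Q p
  have hXp := hharnack p hpS
  have h20 : ∀ {s : ℝ}, (1 / 5 - θ) * nn Q p ≤ s → nn Q p ≤ 20 * s := by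
    intro s hs
    have h3 : 1 / 20 * nn Q p ≤ (1 / 5 - θ) * nn Q p := mul_le_mul_of_nonneg_right (by linarith) hcp.le
    linarith
  by_cases hin : dist (p : E3) z ≤ 6 / 5 * nn Q p
  · -- the core lies in `p`'s shell ball: it is the witness
    have hmargin := nn_shell_ge Q (by linarith) hpc (hzU p hpc) hin
    rw [hnnz] at hmargin
    refine ⟨y, g, hg, hC, hU, hd.trans (by linarith only [hRn]), ?_⟩
    calc nn Q (pt Q x) ≤ M₀ * nn Q p := hXp
      _ ≤ M₀ * (20 * nn Q (pt Q y)) := mul_le_mul_of_nonneg_left (h20 hmargin) hM₀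
      _ = 20 * M₀ * nn Q (pt Q y) := by ring
  · -- shell exit towards the core
    push Not at hin
    obtain ⟨q, hqp, hqd, hqz⟩ := exists_shell_point_closer Q hθ hpc hin
    by_cases hqc : ChartedAt θ Q q
    · -- a charted exit point is reachable and strictly closer: contradicts minimality
      have hqS : Relation.ReflTransGen rel (pt Q x) q := hpS.tail ⟨⟨hpc, hqc, hqp, hqd⟩, hqz.le.trans hpz⟩
      exact absurd (hmin q (hSfin.mem_toFinset.2 hqS)) (not_le.2 hqz)
    · -- an uncharted exit point is charged (the dictionary) and is the witness
      have hqcharged : ¬ IsChargeFree (1 / 100) (Subtype.val : Q.points → E3) q := fun h => hqc (hD Q q h)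
      obtain ⟨y', g', hg', hqeq⟩ := exists_eq_transl_pt Q q
      have hC' : Charged Q y' := by
        intro h; apply hqcharged; rw [hqeq]; exact (Blocks.isChargeFree_transl Q (1 / 100) hg' (pt Q y')).2 h
      have hU' : ¬ ChartedAt θ Q (pt Q y') := fun h => hqc (by rw [hqeq]; exact (chartedAt_transl_iff Q hg' _).2 h)
      have hqv : (q : E3) = (y' : E3) + g' := by rw [hqeq]; rfl
      have hnnq : nn Q q = nn Q (pt Q y') := by rw [hqeq]; exact Blocks.nearestDist_transl Q hg' (pt Q y')
      have hmargin := nn_shell_ge Q (by linarith) hpc hqp hqd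
      rw [hnnq] at hmargin
      refine ⟨y', g', hg', hC', hU', ?_, ?_⟩
      · rw [← hqv]
        calc dist ((pt Q x : Q.points) : E3) q
              ≤ dist ((pt Q x : Q.points) : E3) z + dist (z : E3) q := dist_triangle _ _ _
          _ ≤ D₀ + D₀ := add_le_add hD₀.le (by rw [dist_comm]; exact hqz.le.trans hpz)
          _ ≤ 2 * R * nn Q (pt Q x) := by linarith
      · calc nn Q (pt Q x) ≤ M₀ * nn Q p := hXp
          _ ≤ M₀ * (20 * nn Q (pt Q y')) := mul_le_mul_of_nonneg_left (h20 hmargin) hM₀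
          _ = 20 * M₀ * nn Q (pt Q y') := by ring

/-- UPGRADE from the `x`-centred form: `ChainHarnack θ (2R) M₀ → ChargeFreeCharted θ → UpgradeWitness θ R (20·M₀) (2R)`. -/
theorem upgradeWitness_of_chainHarnack {θ R M₀ : ℝ} (hθ : θ ≤ 3 / 20) (hM₀ : 0 ≤ M₀)
    (hH : ChainHarnack θ (2 * R) M₀) (hD : ChargeFreeCharted θ) : UpgradeWitness θ R (20 * M₀) (2 * R) :=
  upgradeWitness_of_chainHarnackIn hθ hM₀ (chainHarnackIn_of_chainHarnack hH) hD

/-- COLLAR from the ball-anywhere chain Harnack and the dictionary (energy-free; packing count part D). -/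
theorem collarPricing_of_chainHarnackIn {θ R M₀ : ℝ} (hθ : θ ≤ 3 / 20) (hR : 0 < R) (hM₀ : 0 ≤ M₀)
    (hH : ChainHarnackIn θ R M₀) (hD : ChargeFreeCharted θ) : CollarPricing θ R :=
  collarPricing_of_upgrade (by positivity) (by positivity) (upgradeWitness_of_chainHarnackIn hθ hM₀ hH hD)

/-- **The line beneath P after parts C–H**: `FAR θ R ∧ NOZOOM-In θ R M₀ ∧ DICTIONARY θ ⟹ ChartedChargePricing θ`. -/
theorem chartedChargePricing_of_far_chainHarnackIn {θ R M₀ : ℝ} (hθ : θ ≤ 3 / 20) (hR : 0 < R) (hM₀ : 0 ≤ M₀)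
    (hF : FarFieldPricing θ R) (hH : ChainHarnackIn θ R M₀) (hD : ChargeFreeCharted θ) :
    ChartedChargePricing θ :=
  chartedChargePricing_of_far_collar hF (collarPricing_of_chainHarnackIn hθ hR hM₀ hH hD)

/-- COLLAR from chain Harnack and the dictionary (energy-free; packing count part D). -/
theorem collarPricing_of_chainHarnack {θ R M₀ : ℝ} (hθ : θ ≤ 3 / 20) (hR : 0 < R) (hM₀ : 0 ≤ M₀)
    (hH : ChainHarnack θ (2 * R) M₀) (hD : ChargeFreeCharted θ) : CollarPricing θ R :=
  collarPricing_of_upgrade (by positivity) (by positivity) (upgradeWitness_of_chainHarnack hθ hM₀ hH hD)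

/-- **The line beneath P after parts C–G**: `FAR θ R ∧ NOZOOM θ 2R M₀ ∧ DICTIONARY θ ⟹ ChartedChargePricing θ`. -/
theorem chartedChargePricing_of_far_chainHarnack {θ R M₀ : ℝ} (hθ : θ ≤ 3 / 20) (hR : 0 < R) (hM₀ : 0 ≤ M₀)
    (hF : FarFieldPricing θ R) (hH : ChainHarnack θ (2 * R) M₀) (hD : ChargeFreeCharted θ) :
    ChartedChargePricing θ :=
  chartedChargePricing_of_far_collar hF (collarPricing_of_chainHarnack hθ hR hM₀ hH hD)

end assembly

end Summit.AtomisticToContinuum.Crystallization.Theorems.ChargedEnergyGapChartDial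

end
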